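import Literature.NumberTheory.Sieve.HyperbolicShellPairCounts
import Literature.NumberTheory.Sieve.LinearPairDivisorShortSums
import Literature.NumberTheory.Sieve.LinearCongruencePairs
import HarnessLib

/-!
# Divisor pairs of two linear forms in a thin hyperbolic shell

Topic `Literature/NumberTheory/Sieve`.  Everything here is PROVED; no definition is introduced.
Fix integers `q₀, q₁ ≥ 1`, `a₀, a₁` with `gcd(q₀,a₀) = gcd(q₁,a₁) = 1` and
`Δ = q₁a₀ − q₀a₁ ≠ 0` (the two forms `q₀n + a₀`, `q₁n + a₁` are not proportional).  For
`x ≥ 3`, `X`, `κ ∈ (0,1]` let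

  `N(X, κ) = #{(n, d₀, d₁) : 1 ≤ n ≤ x, d₀ ∣ q₀n + a₀ ≥ 1, d₁ ∣ q₁n + a₁ ≥ 1, X < d₀d₁ ≤ (1+κ)X}`

(with `d₀, d₁` ranging over an arbitrary box `[1,B]²`; all bounds are uniform in `B`).  The main
result `LinearPairShells.card_shell_le` is

  `N(X, κ) ≤ C (κ x (log x)^{A+3} + x (log x)^{−A})`  for `x^{1/2} ≤ X ≤ x^{3/2}`,

for every `A`, with `C` depending on `q₀, a₀, q₁, a₁, A`.  This is the estimate used to discard the
shells `X < d₀d₁ ≤ (1+κ)X`, `κ = (log x)^{−C}`, that are left over when the sharp hyperbolic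
cut-offs of a divisor problem for the pair of linear forms are replaced by box-uniform ones
(dispersion method in the middle range).

* `card_pair_sol_le` — the `n` in a set of diameter `t` with `d₀ ∣ q₀n + a₀`, `d₁ ∣ q₁n + a₁`
  number at most `t|Δ|/(d₀d₁) + 1` (one class modulo `lcm(d₀,d₁)`, and `gcd(d₀,d₁) ∣ Δ`);
* `card_shell_le_direct` — the direct count `(x|Δ|/X + 1)(2κX(1 + log 2X) + 2√(2X))`, good for
  `X ≤ x (log x)^{A+1}` (`card_shell_le_of_le`);
* `card_shell_le_switched` — the count through the complementary divisors
  `mᵢ = (qᵢn + aᵢ)/dᵢ`, `m₀m₁ ≤ W ≍ x²/X`, good for `X ≥ x (log x)^{A+1}` (`card_shell_le_of_ge`);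
* `card_shell_le` — the two regimes combined.

The lattice-point counts (pairs in a thin hyperbolic shell, weighted count under a hyperbola)
are in `HyperbolicShellPairCounts.lean`; the structure of the solution set of the pair of
congruences is `LinearCongruencePair.pair_dvd_iff_modEq` / `gcd_dvd_resultant_of_sol`
(`LinearCongruencePairs.lean`).

## References

* Dirichlet's hyperbola method and the Chinese remainder theorem; cf. H. Iwaniec, E. Kowalski,
  *Analytic Number Theory*, §1.5. [folklore]
-/

open Finset Real

namespace Literature.NumberTheory.Sieve

namespace LinearPairShells

open HyperbolicShell

/-! ### Solutions of a pair of linear congruences in a short set -/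

/-- **Solutions of a pair of linear congruences in a set of bounded diameter.**  For
`gcd(q₀,a₀) = gcd(q₁,a₁) = 1`, `Δ = q₁a₀ − q₀a₁ ≠ 0` and `d₀, d₁ ≥ 1`: a finite set of naturals `n`
with `d₀ ∣ q₀n + a₀`, `d₁ ∣ q₁n + a₁`, of diameter at most `t ≥ 0`, has at most
`t|Δ|/(d₀d₁) + 1` elements (the solutions form one class modulo `lcm(d₀,d₁) ≥ d₀d₁/|Δ|`, since
`gcd(d₀,d₁) ∣ Δ`). [folklore] -/
theorem card_pair_sol_le {q₀ a₀ q₁ a₁ : ℤ} (hq₀ : IsCoprime q₀ a₀) (hq₁ : IsCoprime q₁ a₁)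
    (hΔ : q₁ * a₀ - q₀ * a₁ ≠ 0) {d₀ d₁ : ℕ} (hd₀ : 0 < d₀) (hd₁ : 0 < d₁) (S : Finset ℕ)
    (hS : ∀ n ∈ S, (d₀ : ℤ) ∣ q₀ * n + a₀ ∧ (d₁ : ℤ) ∣ q₁ * n + a₁) {t : ℝ} (ht : 0 ≤ t)
    (hdiam : ∀ a ∈ S, ∀ b ∈ S, (b : ℝ) - a ≤ t) :
    (S.card : ℝ) ≤ t * |((q₁ * a₀ - q₀ * a₁ : ℤ) : ℝ)| / ((d₀ : ℝ) * d₁) + 1 := by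
  have hd₀' : (0 : ℝ) < d₀ := by exact_mod_cast hd₀
  have hd₁' : (0 : ℝ) < d₁ := by exact_mod_cast hd₁
  rcases S.eq_empty_or_nonempty with rfl | ⟨ν, hν⟩
  · simp only [Finset.card_empty, Nat.cast_zero]; positivity
  · obtain ⟨hν₀, hν₁⟩ := hS ν hν
    set L : ℕ := Nat.lcm d₀ d₁ with hL
    have hLpos : 0 < L := Nat.lcm_pos hd₀ hd₁
    have hmod : ∀ a ∈ S, ∀ b ∈ S, a ≡ b [MOD L] := by
      have hcls : ∀ n ∈ S, n ≡ ν [MOD L] := by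
        intro n hn
        have h := (LinearCongruencePair.pair_dvd_iff_modEq hq₀ hq₁ hν₀ hν₁ (n : ℤ)).1 (hS n hn)
        exact (Int.natCast_modEq_iff).1 h
      intro a ha b hb
      exact (hcls a ha).trans (hcls b hb).symm
    have h1 := card_le_of_modEq_of_diam_le hLpos hmod ht hdiam
    refine h1.trans ?_
    -- `t / L ≤ t |Δ| / (d₀ d₁)` since `gcd(d₀,d₁) L = d₀ d₁` and `gcd(d₀,d₁) ≤ |Δ|`
    have hg := LinearCongruencePair.gcd_dvd_resultant_of_sol hν₀ hν₁
    have hgle : ((Nat.gcd d₀ d₁ : ℕ) : ℝ) ≤ |((q₁ * a₀ - q₀ * a₁ : ℤ) : ℝ)| := by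
      have h2 : Nat.gcd d₀ d₁ ∣ (q₁ * a₀ - q₀ * a₁).natAbs := Int.natCast_dvd.1 hg
      have h3 : Nat.gcd d₀ d₁ ≤ (q₁ * a₀ - q₀ * a₁).natAbs :=
        Nat.le_of_dvd (Int.natAbs_pos.2 hΔ) h2
      have h4 : ((Nat.gcd d₀ d₁ : ℕ) : ℤ) ≤ |q₁ * a₀ - q₀ * a₁| := by
        rw [← Int.natCast_natAbs]; exact_mod_cast h3
      have h5 : (((Nat.gcd d₀ d₁ : ℕ) : ℤ) : ℝ) ≤ ((|q₁ * a₀ - q₀ * a₁| : ℤ) : ℝ) := by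
        exact_mod_cast h4
      rwa [Int.cast_natCast, Int.cast_abs] at h5
    have hgL : ((Nat.gcd d₀ d₁ : ℕ) : ℝ) * L = (d₀ : ℝ) * d₁ := by
      rw [hL]; exact_mod_cast Nat.gcd_mul_lcm d₀ d₁
    have hL' : (0 : ℝ) < L := by exact_mod_cast hLpos
    have hkey : t / L ≤ t * |((q₁ * a₀ - q₀ * a₁ : ℤ) : ℝ)| / ((d₀ : ℝ) * d₁) := by
      rw [← hgL, div_le_div_iff₀ hL' (by positivity)]
      have hgt : t * ((Nat.gcd d₀ d₁ : ℕ) : ℝ) ≤ t * |((q₁ * a₀ - q₀ * a₁ : ℤ) : ℝ)| :=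
        mul_le_mul_of_nonneg_left hgle ht
      calc t * (((Nat.gcd d₀ d₁ : ℕ) : ℝ) * L) = t * ((Nat.gcd d₀ d₁ : ℕ) : ℝ) * L := by ring
        _ ≤ t * |((q₁ * a₀ - q₀ * a₁ : ℤ) : ℝ)| * L := mul_le_mul_of_nonneg_right hgt hL'.le
    linarith


/-! ### Divisor pairs of a linear pair in a shell: the direct count -/

/-- **The shell count, direct form.**  For `gcd(qᵢ,aᵢ) = 1`, `Δ = q₁a₀ − q₀a₁ ≠ 0`, `X ≥ 1`,
`Y ≥ 0` and all `x, B`: the number of `(n, d₀, d₁) ∈ [1,x] × [1,B]²` with `d₀ ∣ q₀n + a₀ ≥ 1`,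
`d₁ ∣ q₁n + a₁ ≥ 1` and `X < d₀d₁ ≤ X + Y` is at most
`(x|Δ|/X + 1) · (2Y(1 + log(X+Y)) + 2√(X+Y))` (for each pair `(d₀,d₁)` the `n` form one class
modulo `lcm(d₀,d₁) ≥ d₀d₁/|Δ| > X/|Δ|`). [folklore] -/
theorem card_shell_le_direct {q₀ a₀ q₁ a₁ : ℤ} (hq₀ : IsCoprime q₀ a₀) (hq₁ : IsCoprime q₁ a₁)
    (hΔ : q₁ * a₀ - q₀ * a₁ ≠ 0) (x B : ℕ) {X Y : ℝ} (hX : 1 ≤ X) (hY : 0 ≤ Y) :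
    ((((Icc 1 x) ×ˢ ((Icc 1 B) ×ˢ (Icc 1 B))).filter fun c : ℕ × ℕ × ℕ =>
        ((1 ≤ q₀ * c.1 + a₀ ∧ (c.2.1 : ℤ) ∣ q₀ * c.1 + a₀) ∧
          (1 ≤ q₁ * c.1 + a₁ ∧ (c.2.2 : ℤ) ∣ q₁ * c.1 + a₁)) ∧
        (X < (c.2.1 : ℝ) * c.2.2 ∧ (c.2.1 : ℝ) * c.2.2 ≤ X + Y)).card : ℝ) ≤
      ((x : ℝ) * |((q₁ * a₀ - q₀ * a₁ : ℤ) : ℝ)| / X + 1) *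
        (2 * Y * (1 + Real.log (X + Y)) + 2 * Real.sqrt (X + Y)) := by
  set D : ℝ := |((q₁ * a₀ - q₀ * a₁ : ℤ) : ℝ)| with hD
  have hD0 : 0 ≤ D := abs_nonneg _
  have hX0 : 0 < X := by linarith
  set Kc : ℝ := (x : ℝ) * D / X + 1 with hKc
  have hKc0 : 0 ≤ Kc := by positivity
  rw [Finset.card_filter, Nat.cast_sum, Finset.sum_product, Finset.sum_comm]
  -- the count of `n` for a fixed pair `(d₀, d₁)`
  have hpt : ∀ p ∈ (Icc 1 B) ×ˢ (Icc 1 B),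
      ∑ n ∈ Icc 1 x, (((if (((1 ≤ q₀ * ((n, p).1 : ℕ) + a₀ ∧ ((n, p).2.1 : ℤ) ∣ q₀ * ((n, p).1 : ℕ) + a₀) ∧
          (1 ≤ q₁ * ((n, p).1 : ℕ) + a₁ ∧ ((n, p).2.2 : ℤ) ∣ q₁ * ((n, p).1 : ℕ) + a₁)) ∧
          (X < ((n, p).2.1 : ℝ) * (n, p).2.2 ∧ ((n, p).2.1 : ℝ) * (n, p).2.2 ≤ X + Y))
          then 1 else 0 : ℕ)) : ℝ) ≤
        if (X < (p.1 : ℝ) * p.2 ∧ (p.1 : ℝ) * p.2 ≤ X + Y) then Kc else 0 := by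
    rintro ⟨d₀, d₁⟩ hp
    rw [Finset.mem_product, Finset.mem_Icc, Finset.mem_Icc] at hp
    obtain ⟨⟨hd₀, -⟩, ⟨hd₁, -⟩⟩ := hp
    dsimp only
    by_cases hw : X < (d₀ : ℝ) * d₁ ∧ (d₀ : ℝ) * d₁ ≤ X + Y
    · rw [if_pos hw]
      set T := (Icc 1 x).filter fun n : ℕ =>
        (1 ≤ q₀ * (n : ℤ) + a₀ ∧ (d₀ : ℤ) ∣ q₀ * (n : ℤ) + a₀) ∧
          (1 ≤ q₁ * (n : ℤ) + a₁ ∧ (d₁ : ℤ) ∣ q₁ * (n : ℤ) + a₁) with hT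
      have hsum : ∑ n ∈ Icc 1 x, (((if (((1 ≤ q₀ * (n : ℤ) + a₀ ∧ (d₀ : ℤ) ∣ q₀ * (n : ℤ) + a₀) ∧
          (1 ≤ q₁ * (n : ℤ) + a₁ ∧ (d₁ : ℤ) ∣ q₁ * (n : ℤ) + a₁)) ∧
          (X < (d₀ : ℝ) * d₁ ∧ (d₀ : ℝ) * d₁ ≤ X + Y)) then 1 else 0 : ℕ)) : ℝ) = (T.card : ℝ) := by
        rw [hT, Finset.card_filter, Nat.cast_sum]
        refine Finset.sum_congr rfl fun n _ => ?_
        by_cases hd : (1 ≤ q₀ * (n : ℤ) + a₀ ∧ (d₀ : ℤ) ∣ q₀ * (n : ℤ) + a₀) ∧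
            (1 ≤ q₁ * (n : ℤ) + a₁ ∧ (d₁ : ℤ) ∣ q₁ * (n : ℤ) + a₁)
        · rw [if_pos ⟨hd, hw⟩, if_pos hd]
        · rw [if_neg (fun h => hd h.1), if_neg hd]
      rw [hsum]
      have hTS : ∀ n ∈ T, (d₀ : ℤ) ∣ q₀ * n + a₀ ∧ (d₁ : ℤ) ∣ q₁ * n + a₁ := by
        intro n hn
        rw [hT, Finset.mem_filter] at hn
        exact ⟨hn.2.1.2, hn.2.2.2⟩
      have hdiam : ∀ a ∈ T, ∀ b ∈ T, (b : ℝ) - a ≤ x := by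
        intro a ha b hb
        rw [hT, Finset.mem_filter, Finset.mem_Icc] at ha hb
        have h1 : (b : ℝ) ≤ x := by exact_mod_cast hb.1.2
        have h2 : (0 : ℝ) ≤ a := Nat.cast_nonneg a
        linarith
      have h1 := card_pair_sol_le hq₀ hq₁ hΔ hd₀ hd₁ T hTS (Nat.cast_nonneg x) hdiam
      refine h1.trans ?_
      rw [hKc]
      have hdd : X < (d₀ : ℝ) * d₁ := hw.1
      have : (x : ℝ) * D / ((d₀ : ℝ) * d₁) ≤ (x : ℝ) * D / X :=
        div_le_div_of_nonneg_left (by positivity) hX0 hdd.le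
      linarith
    · rw [if_neg hw]
      refine le_of_eq (Finset.sum_eq_zero fun n _ => ?_)
      rw [if_neg (fun h => hw h.2), Nat.cast_zero]
  refine (Finset.sum_le_sum hpt).trans ?_
  rw [← Finset.sum_filter, Finset.sum_const, nsmul_eq_mul, mul_comm]
  exact mul_le_mul_of_nonneg_left (card_pairs_shell_le hX hY B) hKc0


/-! ### Divisor pairs of a linear pair in a shell: the switched count -/

/-- The `n`-range of a window for the complementary divisors is short: if `a ≤ b ≤ x`,
`u(a) = q₀a + a₀ ≥ 1`, `v(a) = q₁a + a₁ ≥ 1` (`q₀, q₁ ≥ 1`), `X·P < u(a)v(a)` and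
`u(b)v(b) ≤ (X + Y)·P` with `X > 0`, `Y ≥ 0`, then `b − a ≤ (x + |a₀|) Y / X`. [folklore] -/
theorem sub_le_of_window {q₀ a₀ q₁ a₁ : ℤ} (hq₀ : 0 < q₀) (hq₁ : 0 < q₁) {x a b : ℕ}
    {X Y P : ℝ} (hX : 0 < X) (hY : 0 ≤ Y) (hab : a ≤ b) (hbx : b ≤ x)
    (hua : 1 ≤ q₀ * a + a₀) (hva : 1 ≤ q₁ * a + a₁)
    (hlow : X * P < ((q₀ : ℝ) * a + a₀) * ((q₁ : ℝ) * a + a₁))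
    (hupp : ((q₀ : ℝ) * b + a₀) * ((q₁ : ℝ) * b + a₁) ≤ (X + Y) * P) :
    (b : ℝ) - a ≤ ((x : ℝ) + |(a₀ : ℝ)|) * Y / X := by
  set ua : ℝ := (q₀ : ℝ) * a + a₀ with hua'
  set va : ℝ := (q₁ : ℝ) * a + a₁ with hva'
  set δ : ℝ := (b : ℝ) - a with hδ
  have hab' : (a : ℝ) ≤ b := by exact_mod_cast hab
  have hδ0 : 0 ≤ δ := by rw [hδ]; linarith
  have hq₀' : (1 : ℝ) ≤ q₀ := by exact_mod_cast hq₀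
  have hq₁' : (1 : ℝ) ≤ q₁ := by exact_mod_cast hq₁
  have hua1 : (1 : ℝ) ≤ ua := by
    have : ((1 : ℤ) : ℝ) ≤ ((q₀ * a + a₀ : ℤ) : ℝ) := by exact_mod_cast hua
    push_cast at this; rw [hua']; linarith
  have hva1 : (1 : ℝ) ≤ va := by
    have : ((1 : ℤ) : ℝ) ≤ ((q₁ * a + a₁ : ℤ) : ℝ) := by exact_mod_cast hva
    push_cast at this; rw [hva']; linarith
  have hub : (q₀ : ℝ) * b + a₀ = ua + q₀ * δ := by rw [hua', hδ]; ring
  have hvb : (q₁ : ℝ) * b + a₁ = va + q₁ * δ := by rw [hva', hδ]; ring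
  rw [hub, hvb] at hupp
  -- `(ua + q₀ δ) va ≤ (ua + q₀ δ)(va + q₁ δ) ≤ (X+Y) P` and `X P < ua va`
  have h1 : (ua + q₀ * δ) * va ≤ (X + Y) * P := by
    have : (ua + q₀ * δ) * va ≤ (ua + q₀ * δ) * (va + q₁ * δ) := by
      apply mul_le_mul_of_nonneg_left _ (by positivity)
      have : 0 ≤ (q₁ : ℝ) * δ := by positivity
      linarith
    linarith
  have h2 : (ua + q₀ * δ) * va * X < (X + Y) * (ua * va) := by
    have hXY : 0 < X + Y := by linarith
    calc (ua + q₀ * δ) * va * X ≤ (X + Y) * P * X := mul_le_mul_of_nonneg_right h1 hX.le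
      _ = (X + Y) * (X * P) := by ring
      _ < (X + Y) * (ua * va) := mul_lt_mul_of_pos_left hlow hXY
  -- hence `q₀ δ X < Y ua`
  have h3 : va * ((q₀ : ℝ) * δ * X - Y * ua) < 0 := by nlinarith
  have h4 : (q₀ : ℝ) * δ * X < Y * ua := by
    by_contra h
    push Not at h
    have : 0 ≤ va * ((q₀ : ℝ) * δ * X - Y * ua) := mul_nonneg (by linarith) (by linarith)
    linarith
  -- and `ua ≤ q₀ (x + |a₀|)`
  have h5 : ua ≤ (q₀ : ℝ) * ((x : ℝ) + |(a₀ : ℝ)|) := by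
    have hax : (a : ℝ) ≤ x := by exact_mod_cast hab.trans hbx
    have ha₀ : (a₀ : ℝ) ≤ |(a₀ : ℝ)| := le_abs_self _
    have hab₀ : |(a₀ : ℝ)| ≤ (q₀ : ℝ) * |(a₀ : ℝ)| := le_mul_of_one_le_left (abs_nonneg _) hq₀'
    rw [hua']; nlinarith
  have h6 : δ * X < ((x : ℝ) + |(a₀ : ℝ)|) * Y := by
    have : (q₀ : ℝ) * (δ * X) < (q₀ : ℝ) * (((x : ℝ) + |(a₀ : ℝ)|) * Y) := by
      have hYua : Y * ua ≤ Y * ((q₀ : ℝ) * ((x : ℝ) + |(a₀ : ℝ)|)) := mul_le_mul_of_nonneg_left h5 hY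
      nlinarith
    exact lt_of_mul_lt_mul_left this (by linarith)
  rw [le_div_iff₀ hX]
  exact h6.le


/-- Complementary divisors determine the divisor: if `e, e' ∣ w` (`w ≥ 1`, `e, e'` naturals)
and `w/e = w/e'`, then `e = e'`. [folklore] -/
theorem eq_of_ediv_toNat_eq {w : ℤ} {e e' : ℕ} (hw : 1 ≤ w) (he : (e : ℤ) ∣ w)
    (he' : (e' : ℤ) ∣ w) (hee : (w / e).toNat = (w / e').toNat) : e = e' := by
  obtain ⟨k, hk⟩ := he
  obtain ⟨k', hk'⟩ := he'
  have he0 : (0 : ℤ) < e := by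
    rcases Nat.eq_zero_or_pos e with h | h
    · exfalso; rw [h] at hk; simp at hk; omega
    · exact_mod_cast h
  have he0' : (0 : ℤ) < e' := by
    rcases Nat.eq_zero_or_pos e' with h | h
    · exfalso; rw [h] at hk'; simp at hk'; omega
    · exact_mod_cast h
  have hk1 : w / e = k := by rw [hk, Int.mul_ediv_cancel_left _ he0.ne']
  have hk1' : w / e' = k' := by rw [hk', Int.mul_ediv_cancel_left _ he0'.ne']
  have hkpos : 0 < k := by
    by_contra h; push Not at h
    have : (e : ℤ) * k ≤ 0 := mul_nonpos_of_nonneg_of_nonpos he0.le h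
    omega
  have hkpos' : 0 < k' := by
    by_contra h; push Not at h
    have : (e' : ℤ) * k' ≤ 0 := mul_nonpos_of_nonneg_of_nonpos he0'.le h
    omega
  rw [hk1, hk1'] at hee
  have hkk : k = k' := by
    have h2 : ((k.toNat : ℕ) : ℤ) = ((k'.toNat : ℕ) : ℤ) := by exact_mod_cast hee
    rwa [Int.toNat_of_nonneg hkpos.le, Int.toNat_of_nonneg hkpos'.le] at h2
  rw [← hkk] at hk'
  have : (e : ℤ) * k = (e' : ℤ) * k := by rw [← hk, ← hk']
  have := mul_right_cancel₀ hkpos.ne' this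
  exact_mod_cast this

/-- **The shell count, switched form.**  For `q₀, q₁ ≥ 1`, `gcd(qᵢ,aᵢ) = 1`,
`Δ = q₁a₀ − q₀a₁ ≠ 0`, `X > 0`, `Y ≥ 0`, `W ≥ 1` with `(q₀x + |a₀|)(q₁x + |a₁|) ≤ W X`, and all
`B`: the number of `(n, d₀, d₁) ∈ [1,x] × [1,B]²` with `d₀ ∣ q₀n + a₀ ≥ 1`, `d₁ ∣ q₁n + a₁ ≥ 1`,
`X < d₀d₁ ≤ X + Y` is at most `((x + |a₀|)Y/X)·|Δ|·(1 + log W)² + W(1 + log W)`: pass to the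
complementary divisors `mᵢ = (qᵢn + aᵢ)/dᵢ`, `m₀m₁ ≤ W`; for fixed `(m₀, m₁)` the admissible `n`
lie in one class modulo `lcm(m₀,m₁) ≥ m₀m₁/|Δ|` and in an interval of length `(x + |a₀|)Y/X`.
[folklore] -/
theorem card_shell_le_switched {q₀ a₀ q₁ a₁ : ℤ} (hq₀p : 0 < q₀) (hq₁p : 0 < q₁)
    (hq₀ : IsCoprime q₀ a₀) (hq₁ : IsCoprime q₁ a₁) (hΔ : q₁ * a₀ - q₀ * a₁ ≠ 0) (x B : ℕ)
    {X Y W : ℝ} (hX : 0 < X) (hY : 0 ≤ Y) (hW : 1 ≤ W)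
    (hFW : ((q₀ : ℝ) * x + |(a₀ : ℝ)|) * ((q₁ : ℝ) * x + |(a₁ : ℝ)|) ≤ W * X) :
    ((((Icc 1 x) ×ˢ ((Icc 1 B) ×ˢ (Icc 1 B))).filter fun c : ℕ × ℕ × ℕ =>
        ((1 ≤ q₀ * c.1 + a₀ ∧ (c.2.1 : ℤ) ∣ q₀ * c.1 + a₀) ∧
          (1 ≤ q₁ * c.1 + a₁ ∧ (c.2.2 : ℤ) ∣ q₁ * c.1 + a₁)) ∧
        (X < (c.2.1 : ℝ) * c.2.2 ∧ (c.2.1 : ℝ) * c.2.2 ≤ X + Y)).card : ℝ) ≤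
      ((x : ℝ) + |(a₀ : ℝ)|) * Y / X * |((q₁ * a₀ - q₀ * a₁ : ℤ) : ℝ)| * (1 + Real.log W) ^ 2 +
        W * (1 + Real.log W) := by
  set D : ℝ := |((q₁ * a₀ - q₀ * a₁ : ℤ) : ℝ)| with hD
  have hD0 : 0 ≤ D := abs_nonneg _
  set t : ℝ := ((x : ℝ) + |(a₀ : ℝ)|) * Y / X with ht
  have ht0 : 0 ≤ t := by positivity
  -- the bound `B'` for the complementary divisors
  set B' : ℕ := q₀.toNat * x + a₀.natAbs + q₁.toNat * x + a₁.natAbs with hB'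
  have hB'Z : (B' : ℤ) = q₀ * x + |a₀| + q₁ * x + |a₁| := by
    rw [hB']; push_cast; rw [Int.toNat_of_nonneg hq₀p.le, Int.toNat_of_nonneg hq₁p.le]
  -- the switched set
  set T := ((Icc 1 x) ×ˢ ((Icc 1 B) ×ˢ (Icc 1 B))).filter fun c : ℕ × ℕ × ℕ =>
        ((1 ≤ q₀ * c.1 + a₀ ∧ (c.2.1 : ℤ) ∣ q₀ * c.1 + a₀) ∧
          (1 ≤ q₁ * c.1 + a₁ ∧ (c.2.2 : ℤ) ∣ q₁ * c.1 + a₁)) ∧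
        (X < (c.2.1 : ℝ) * c.2.2 ∧ (c.2.1 : ℝ) * c.2.2 ≤ X + Y) with hT
  set T' := ((Icc 1 x) ×ˢ ((Icc 1 B') ×ˢ (Icc 1 B'))).filter fun c : ℕ × ℕ × ℕ =>
        ((1 ≤ q₀ * c.1 + a₀ ∧ (c.2.1 : ℤ) ∣ q₀ * c.1 + a₀) ∧
          (1 ≤ q₁ * c.1 + a₁ ∧ (c.2.2 : ℤ) ∣ q₁ * c.1 + a₁)) ∧
        (X * ((c.2.1 : ℝ) * c.2.2) < ((q₀ : ℝ) * c.1 + a₀) * ((q₁ : ℝ) * c.1 + a₁) ∧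
          ((q₀ : ℝ) * c.1 + a₀) * ((q₁ : ℝ) * c.1 + a₁) ≤ (X + Y) * ((c.2.1 : ℝ) * c.2.2)) with hT'
  -- Step 1: `#T ≤ #T'` by `(n, d₀, d₁) ↦ (n, u/d₀, v/d₁)`
  have hstep1 : T.card ≤ T'.card := by
    refine Finset.card_le_card_of_injOn
      (fun c : ℕ × ℕ × ℕ => (c.1, ((q₀ * c.1 + a₀) / c.2.1).toNat, ((q₁ * c.1 + a₁) / c.2.2).toNat)) ?_ ?_
    · rintro ⟨n, d₀, d₁⟩ hc
      rw [Finset.mem_coe, hT, Finset.mem_filter, Finset.mem_product, Finset.mem_product,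
        Finset.mem_Icc, Finset.mem_Icc, Finset.mem_Icc] at hc
      obtain ⟨⟨⟨hn1, hnx⟩, ⟨hd₀1, -⟩, ⟨hd₁1, -⟩⟩, ⟨⟨hu1, hd₀u⟩, ⟨hv1, hd₁v⟩⟩, hw1, hw2⟩ := hc
      dsimp only at hn1 hnx hd₀1 hd₁1 hu1 hd₀u hv1 hd₁v hw1 hw2 ⊢
      set u : ℤ := q₀ * n + a₀ with hu
      set v : ℤ := q₁ * n + a₁ with hv
      set m₀ : ℤ := u / d₀ with hm₀
      set m₁ : ℤ := v / d₁ with hm₁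
      have hum : (d₀ : ℤ) * m₀ = u := Int.mul_ediv_cancel' hd₀u
      have hvm : (d₁ : ℤ) * m₁ = v := Int.mul_ediv_cancel' hd₁v
      have hd₀Z : (1 : ℤ) ≤ d₀ := by exact_mod_cast hd₀1
      have hd₁Z : (1 : ℤ) ≤ d₁ := by exact_mod_cast hd₁1
      have hm₀1 : 1 ≤ m₀ := by
        by_contra h; push Not at h
        have : (d₀ : ℤ) * m₀ ≤ 0 := by nlinarith
        omega
      have hm₁1 : 1 ≤ m₁ := by
        by_contra h; push Not at h
        have : (d₁ : ℤ) * m₁ ≤ 0 := by nlinarith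
        omega
      have hm₀u : m₀ ≤ u := by nlinarith
      have hm₁v : m₁ ≤ v := by nlinarith
      have hnZ : (n : ℤ) ≤ x := by exact_mod_cast hnx
      have huB : u ≤ B' := by
        rw [hB'Z, hu]
        have := le_abs_self a₀; have := abs_nonneg a₁
        have : (0 : ℤ) ≤ q₁ * x := by positivity
        nlinarith
      have hvB : v ≤ B' := by
        rw [hB'Z, hv]
        have := le_abs_self a₁; have := abs_nonneg a₀
        have : (0 : ℤ) ≤ q₀ * x := by positivity
        nlinarith
      have hm₀N : ((m₀.toNat : ℕ) : ℤ) = m₀ := Int.toNat_of_nonneg (by omega)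
      have hm₁N : ((m₁.toNat : ℕ) : ℤ) = m₁ := Int.toNat_of_nonneg (by omega)
      -- `u v = (d₀ d₁)(m₀ m₁)` over `ℝ`
      have huvR : ((q₀ : ℝ) * n + a₀) * ((q₁ : ℝ) * n + a₁) =
          ((d₀ : ℝ) * d₁) * (((m₀.toNat : ℕ) : ℝ) * ((m₁.toNat : ℕ) : ℝ)) := by
        have h : u * v = ((d₀ : ℤ) * d₁) * (((m₀.toNat : ℕ) : ℤ) * ((m₁.toNat : ℕ) : ℤ)) := by
          rw [hm₀N, hm₁N, ← hum, ← hvm]; ring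
        have h' : ((u * v : ℤ) : ℝ) =
            ((((d₀ : ℤ) * d₁) * (((m₀.toNat : ℕ) : ℤ) * ((m₁.toNat : ℕ) : ℤ)) : ℤ) : ℝ) := by
          rw [h]
        rw [hu, hv] at h'
        push_cast at h'
        exact h'
      have hmm : (0 : ℝ) < ((m₀.toNat : ℕ) : ℝ) * ((m₁.toNat : ℕ) : ℝ) := by
        have h0 : (1 : ℝ) ≤ ((m₀.toNat : ℕ) : ℝ) := by
          have : (1 : ℤ) ≤ ((m₀.toNat : ℕ) : ℤ) := by rw [hm₀N]; exact hm₀1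
          exact_mod_cast this
        have h1 : (1 : ℝ) ≤ ((m₁.toNat : ℕ) : ℝ) := by
          have : (1 : ℤ) ≤ ((m₁.toNat : ℕ) : ℤ) := by rw [hm₁N]; exact hm₁1
          exact_mod_cast this
        positivity
      rw [Finset.mem_coe, hT', Finset.mem_filter, Finset.mem_product, Finset.mem_product,
        Finset.mem_Icc, Finset.mem_Icc, Finset.mem_Icc]
      dsimp only
      refine ⟨⟨⟨hn1, hnx⟩, ⟨by omega, by omega⟩, ⟨by omega, by omega⟩⟩,
        ⟨⟨hu1, ?_⟩, ⟨hv1, ?_⟩⟩, ?_, ?_⟩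
      · rw [hm₀N]; exact Dvd.intro_left _ hum
      · rw [hm₁N]; exact Dvd.intro_left _ hvm
      · rw [huvR]; exact mul_lt_mul_of_pos_right hw1 hmm
      · rw [huvR]; exact mul_le_mul_of_nonneg_right hw2 hmm.le
    · rintro ⟨n, d₀, d₁⟩ hc ⟨n', d₀', d₁'⟩ hc' heq
      rw [Finset.mem_coe, hT, Finset.mem_filter] at hc hc'
      obtain ⟨-, ⟨⟨hu1, hd₀u⟩, ⟨hv1, hd₁v⟩⟩, -⟩ := hc
      obtain ⟨-, ⟨⟨hu1', hd₀u'⟩, ⟨hv1', hd₁v'⟩⟩, -⟩ := hc'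
      dsimp only at hu1 hd₀u hv1 hd₁v hu1' hd₀u' hv1' hd₁v' heq
      simp only [Prod.mk.injEq] at heq ⊢
      obtain ⟨hnn, h0, h1⟩ := heq
      subst hnn
      exact ⟨rfl, eq_of_ediv_toNat_eq hu1 hd₀u hd₀u' h0, eq_of_ediv_toNat_eq hv1 hd₁v hd₁v' h1⟩
  -- Step 2: count `T'` through the pairs `(m₀, m₁)`
  have hF0 : 0 ≤ ((q₀ : ℝ) * x + |(a₀ : ℝ)|) * ((q₁ : ℝ) * x + |(a₁ : ℝ)|) := by
    have : (0 : ℝ) ≤ q₀ := by exact_mod_cast hq₀p.le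
    have : (0 : ℝ) ≤ q₁ := by exact_mod_cast hq₁p.le
    positivity
  have hstep2 : (T'.card : ℝ) ≤ ∑ p ∈ (Icc 1 B') ×ˢ (Icc 1 B'),
      (if (p.1 : ℝ) * p.2 ≤ W then t * D / ((p.1 : ℝ) * p.2) + 1 else 0) := by
    rw [hT', Finset.card_filter, Nat.cast_sum, Finset.sum_product, Finset.sum_comm]
    refine Finset.sum_le_sum ?_
    rintro ⟨m₀, m₁⟩ hp
    rw [Finset.mem_product, Finset.mem_Icc, Finset.mem_Icc] at hp
    obtain ⟨⟨hm₀, -⟩, ⟨hm₁, -⟩⟩ := hp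
    dsimp only
    set S := (Icc 1 x).filter fun n : ℕ =>
        ((1 ≤ q₀ * (n : ℤ) + a₀ ∧ (m₀ : ℤ) ∣ q₀ * (n : ℤ) + a₀) ∧
          (1 ≤ q₁ * (n : ℤ) + a₁ ∧ (m₁ : ℤ) ∣ q₁ * (n : ℤ) + a₁)) ∧
        (X * ((m₀ : ℝ) * m₁) < ((q₀ : ℝ) * n + a₀) * ((q₁ : ℝ) * n + a₁) ∧
          ((q₀ : ℝ) * n + a₀) * ((q₁ : ℝ) * n + a₁) ≤ (X + Y) * ((m₀ : ℝ) * m₁)) with hS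
    have hsum : ∑ n ∈ Icc 1 x, (((if (((1 ≤ q₀ * (n : ℤ) + a₀ ∧ (m₀ : ℤ) ∣ q₀ * (n : ℤ) + a₀) ∧
          (1 ≤ q₁ * (n : ℤ) + a₁ ∧ (m₁ : ℤ) ∣ q₁ * (n : ℤ) + a₁)) ∧
        (X * ((m₀ : ℝ) * m₁) < ((q₀ : ℝ) * n + a₀) * ((q₁ : ℝ) * n + a₁) ∧
          ((q₀ : ℝ) * n + a₀) * ((q₁ : ℝ) * n + a₁) ≤ (X + Y) * ((m₀ : ℝ) * m₁)))
          then 1 else 0 : ℕ)) : ℝ) = (S.card : ℝ) := by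
      rw [hS, Finset.card_filter, Nat.cast_sum]
    rw [hsum]
    rcases S.eq_empty_or_nonempty with hSe | ⟨ν, hν⟩
    · rw [hSe, Finset.card_empty, Nat.cast_zero]; split_ifs <;> positivity
    · have hνS := hν
      rw [hS, Finset.mem_filter, Finset.mem_Icc] at hνS
      obtain ⟨⟨-, hνx⟩, ⟨⟨hu1, -⟩, ⟨hv1, -⟩⟩, hwin1, -⟩ := hνS
      -- `m₀ m₁ ≤ W`
      have huv_le : ((q₀ : ℝ) * ν + a₀) * ((q₁ : ℝ) * ν + a₁) ≤
          ((q₀ : ℝ) * x + |(a₀ : ℝ)|) * ((q₁ : ℝ) * x + |(a₁ : ℝ)|) := by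
        have hνx' : (ν : ℝ) ≤ x := by exact_mod_cast hνx
        have hq₀' : (0 : ℝ) ≤ q₀ := by exact_mod_cast hq₀p.le
        have hq₁' : (0 : ℝ) ≤ q₁ := by exact_mod_cast hq₁p.le
        have hu0 : (1 : ℝ) ≤ (q₀ : ℝ) * ν + a₀ := by exact_mod_cast hu1
        have hv0 : (1 : ℝ) ≤ (q₁ : ℝ) * ν + a₁ := by exact_mod_cast hv1
        have h1 : (q₀ : ℝ) * ν + a₀ ≤ (q₀ : ℝ) * x + |(a₀ : ℝ)| :=
          add_le_add (mul_le_mul_of_nonneg_left hνx' hq₀') (le_abs_self _)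
        have h2 : (q₁ : ℝ) * ν + a₁ ≤ (q₁ : ℝ) * x + |(a₁ : ℝ)| :=
          add_le_add (mul_le_mul_of_nonneg_left hνx' hq₁') (le_abs_self _)
        exact mul_le_mul h1 h2 (zero_le_one.trans hv0) (zero_le_one.trans (hu0.trans h1))
      have hmmW : (m₀ : ℝ) * m₁ ≤ W := by
        have h : X * ((m₀ : ℝ) * m₁) ≤ X * W :=
          (hwin1.le.trans (huv_le.trans hFW)).trans_eq (mul_comm W X)
        exact le_of_mul_le_mul_left h hX
      rw [if_pos hmmW]
      have hSsol : ∀ n ∈ S, (m₀ : ℤ) ∣ q₀ * n + a₀ ∧ (m₁ : ℤ) ∣ q₁ * n + a₁ := by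
        intro n hn
        rw [hS, Finset.mem_filter] at hn
        exact ⟨hn.2.1.1.2, hn.2.1.2.2⟩
      have hdiam : ∀ a ∈ S, ∀ b ∈ S, (b : ℝ) - a ≤ t := by
        intro a ha b hb
        rcases le_or_gt a b with hab | hba
        · rw [hS, Finset.mem_filter, Finset.mem_Icc] at ha hb
          obtain ⟨⟨-, -⟩, ⟨⟨hua, -⟩, ⟨hva, -⟩⟩, hlow, -⟩ := ha
          obtain ⟨⟨-, hbx⟩, -, -, hupp⟩ := hb
          exact sub_le_of_window hq₀p hq₁p hX hY hab hbx hua hva hlow hupp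
        · have : (b : ℝ) < a := by exact_mod_cast hba
          exact (sub_nonpos.2 this.le).trans ht0
      exact card_pair_sol_le hq₀ hq₁ hΔ hm₀ hm₁ S hSsol ht0 hdiam
  -- Step 3: the hyperbola sum
  have hstep3 := sum_pairs_hyperbola_le hW (show 0 ≤ t * D by positivity) B'
  calc (T.card : ℝ) ≤ T'.card := by exact_mod_cast hstep1
    _ ≤ _ := hstep2
    _ ≤ t * D * (1 + Real.log W) ^ 2 + W * (1 + Real.log W) := hstep3


/-! ### Assembly: the two regimes and the theorem -/

/-- Elementary facts for `x ≥ 3`: `1 ≤ log x ≤ x`. [folklore] -/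
theorem one_le_log_of_three_le {x : ℝ} (hx : 3 ≤ x) : 1 ≤ Real.log x ∧ Real.log x ≤ x := by
  have hx0 : 0 < x := by linarith
  constructor
  · rw [Real.le_log_iff_exp_le hx0]
    have := Real.exp_one_lt_d9; linarith
  · have := Real.log_le_sub_one_of_pos hx0; linarith

/-- **Regime `X ≤ x (log x)^{A+1}`** of the shell bound (direct count): for `x ≥ 3`,
`x^{1/2} ≤ X ≤ x (log x)^{A+1}`, `0 < κ ≤ 1` the shell count with `Y = κX` is at most
`C (κ x (log x)^{A+3} + x/(log x)^A)`. [folklore] -/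
theorem card_shell_le_of_le {q₀ a₀ q₁ a₁ : ℤ} (hq₀ : IsCoprime q₀ a₀) (hq₁ : IsCoprime q₁ a₁)
    (hΔ : q₁ * a₀ - q₀ * a₁ ≠ 0) (A : ℕ) :
    ∃ C : ℝ, 0 < C ∧ ∀ (x B : ℕ) (X κ : ℝ), 3 ≤ x → (x : ℝ) ^ (1 / 2 : ℝ) ≤ X →
      X ≤ (x : ℝ) * Real.log x ^ (A + 1) → 0 < κ → κ ≤ 1 →
      ((((Icc 1 x) ×ˢ ((Icc 1 B) ×ˢ (Icc 1 B))).filter fun c : ℕ × ℕ × ℕ =>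
        ((1 ≤ q₀ * c.1 + a₀ ∧ (c.2.1 : ℤ) ∣ q₀ * c.1 + a₀) ∧
          (1 ≤ q₁ * c.1 + a₁ ∧ (c.2.2 : ℤ) ∣ q₁ * c.1 + a₁)) ∧
        (X < (c.2.1 : ℝ) * c.2.2 ∧ (c.2.1 : ℝ) * c.2.2 ≤ X + κ * X)).card : ℝ) ≤
      C * (κ * x * Real.log x ^ (A + 3) + x / Real.log x ^ A) := by
  set D : ℝ := |((q₁ * a₀ - q₀ * a₁ : ℤ) : ℝ)| with hD
  have hD0 : 0 ≤ D := abs_nonneg _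
  obtain ⟨K₁, hK₁, hK₁b⟩ := exists_log_pow_le_mul_rpow A (show (0 : ℝ) < 1 / 4 by norm_num)
  obtain ⟨K₂, hK₂, hK₂b⟩ := exists_log_pow_le_mul_rpow (2 * A + 1) (show (0 : ℝ) < 1 / 2 by norm_num)
  refine ⟨2 * ((A : ℝ) + 4) * (D + 1) + 2 * Real.sqrt 2 * (D * K₁ + K₂), by positivity, ?_⟩
  intro x B X κ hx3 hXlo hXhi hκ0 hκ1
  have hx3R : (3 : ℝ) ≤ x := by exact_mod_cast hx3
  have hx0 : (0 : ℝ) < x := by linarith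
  have hx1 : (1 : ℝ) ≤ x := by linarith
  obtain ⟨hL1, hLx⟩ := one_le_log_of_three_le hx3R
  set L : ℝ := Real.log x with hL
  have hL0 : 0 < L := by linarith
  have hX1 : 1 ≤ X := le_trans (Real.one_le_rpow hx1 (by norm_num)) hXlo
  have hX0 : 0 < X := by linarith
  have hY0 : 0 ≤ κ * X := by positivity
  have hN := card_shell_le_direct hq₀ hq₁ hΔ x B hX1 hY0
  refine hN.trans ?_
  -- `1 + log (X + κX) ≤ (A + 4) L`
  have hM : 1 + Real.log (X + κ * X) ≤ ((A : ℝ) + 4) * L := by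
    have h2X : X + κ * X ≤ 2 * (x : ℝ) ^ (A + 2) := by
      have h1 : X + κ * X ≤ 2 * X := by nlinarith
      have h2 : X ≤ (x : ℝ) ^ (A + 2) := by
        calc X ≤ (x : ℝ) * L ^ (A + 1) := hXhi
          _ ≤ (x : ℝ) * (x : ℝ) ^ (A + 1) :=
              mul_le_mul_of_nonneg_left (pow_le_pow_left₀ hL0.le hLx (A + 1)) hx0.le
          _ = (x : ℝ) ^ (A + 2) := by ring
      linarith
    have hpos : 0 < X + κ * X := by positivity
    have h3 : Real.log (X + κ * X) ≤ Real.log 2 + ((A : ℝ) + 2) * L := by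
      calc Real.log (X + κ * X) ≤ Real.log (2 * (x : ℝ) ^ (A + 2)) := Real.log_le_log hpos h2X
        _ = Real.log 2 + ((A : ℝ) + 2) * L := by
            rw [Real.log_mul (by norm_num) (by positivity), Real.log_pow]; push_cast; ring
    have h4 : Real.log 2 ≤ L := by have := Real.log_two_lt_d9; linarith
    nlinarith
  have hM0 : 0 ≤ 1 + Real.log (X + κ * X) := by
    have : 0 ≤ Real.log (X + κ * X) := Real.log_nonneg (by nlinarith)
    linarith
  -- `√(X + κX) ≤ √2 √X`, `√X ≥ x^{1/4}`, `√X ≤ √x L^{A+1}`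
  have hsqrt2X : Real.sqrt (X + κ * X) ≤ Real.sqrt 2 * Real.sqrt X := by
    rw [← Real.sqrt_mul (by norm_num)]
    exact Real.sqrt_le_sqrt (by nlinarith)
  have hsqrtX_lo : (x : ℝ) ^ (1 / 4 : ℝ) ≤ Real.sqrt X := by
    have : Real.sqrt ((x : ℝ) ^ (1 / 2 : ℝ)) = (x : ℝ) ^ (1 / 4 : ℝ) := by
      rw [Real.sqrt_eq_rpow, ← Real.rpow_mul hx0.le]; norm_num
    rw [← this]; exact Real.sqrt_le_sqrt hXlo
  have hsqrtX_hi : Real.sqrt X ≤ Real.sqrt x * L ^ (A + 1) := by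
    have h1 : Real.sqrt X ≤ Real.sqrt ((x : ℝ) * L ^ (A + 1)) := Real.sqrt_le_sqrt hXhi
    have h2 : Real.sqrt ((x : ℝ) * L ^ (A + 1)) = Real.sqrt x * Real.sqrt (L ^ (A + 1)) :=
      Real.sqrt_mul hx0.le _
    have h3 : Real.sqrt (L ^ (A + 1)) ≤ L ^ (A + 1) := by
      have hL1' : 1 ≤ L ^ (A + 1) := one_le_pow₀ hL1
      rw [Real.sqrt_le_iff]; exact ⟨by positivity, by nlinarith⟩
    calc Real.sqrt X ≤ Real.sqrt x * Real.sqrt (L ^ (A + 1)) := h1.trans_eq h2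
      _ ≤ Real.sqrt x * L ^ (A + 1) := mul_le_mul_of_nonneg_left h3 (Real.sqrt_nonneg _)
  -- `x^{3/4} ≤ K₁ x / L^A` and `√x L^{A+1} ≤ K₂ x / L^A`
  have hLA0 : 0 < L ^ A := pow_pos hL0 A
  have h34 : (x : ℝ) / (x : ℝ) ^ (1 / 4 : ℝ) ≤ K₁ * x / L ^ A := by
    have h1 : L ^ A ≤ K₁ * (x : ℝ) ^ (1 / 4 : ℝ) := hK₁b x hx1
    have hx14 : 0 < (x : ℝ) ^ (1 / 4 : ℝ) := by positivity
    rw [div_le_div_iff₀ hx14 hLA0]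
    calc (x : ℝ) * L ^ A ≤ (x : ℝ) * (K₁ * (x : ℝ) ^ (1 / 4 : ℝ)) := mul_le_mul_of_nonneg_left h1 hx0.le
      _ = K₁ * x * (x : ℝ) ^ (1 / 4 : ℝ) := by ring
  have h12 : Real.sqrt x * L ^ (A + 1) ≤ K₂ * x / L ^ A := by
    have h1 : L ^ (2 * A + 1) ≤ K₂ * (x : ℝ) ^ (1 / 2 : ℝ) := hK₂b x hx1
    rw [le_div_iff₀ hLA0]
    have hsx : Real.sqrt x * (x : ℝ) ^ (1 / 2 : ℝ) = x := by
      rw [Real.sqrt_eq_rpow, ← Real.rpow_add hx0]; norm_num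
    calc Real.sqrt x * L ^ (A + 1) * L ^ A = Real.sqrt x * L ^ (2 * A + 1) := by ring
      _ ≤ Real.sqrt x * (K₂ * (x : ℝ) ^ (1 / 2 : ℝ)) :=
          mul_le_mul_of_nonneg_left h1 (Real.sqrt_nonneg _)
      _ = K₂ * (Real.sqrt x * (x : ℝ) ^ (1 / 2 : ℝ)) := by ring
      _ = K₂ * x := by rw [hsx]
  -- the four terms
  have hsX : 0 < Real.sqrt X := Real.sqrt_pos.2 hX0
  have hT1 : (x : ℝ) * D / X * (2 * (κ * X) * (1 + Real.log (X + κ * X))) ≤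
      2 * ((A : ℝ) + 4) * D * (κ * x * L ^ (A + 3)) := by
    have h1 : (x : ℝ) * D / X * (2 * (κ * X) * (1 + Real.log (X + κ * X))) =
        2 * D * (κ * x) * (1 + Real.log (X + κ * X)) := by field_simp
    rw [h1]
    have h2 : L ≤ L ^ (A + 3) := by
      calc L = L ^ 1 := (pow_one L).symm
        _ ≤ L ^ (A + 3) := pow_le_pow_right₀ hL1 (by omega)
    have h3 : 1 + Real.log (X + κ * X) ≤ ((A : ℝ) + 4) * L ^ (A + 3) :=
      hM.trans (mul_le_mul_of_nonneg_left h2 (by positivity))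
    calc 2 * D * (κ * x) * (1 + Real.log (X + κ * X)) ≤ 2 * D * (κ * x) * (((A : ℝ) + 4) * L ^ (A + 3)) :=
          mul_le_mul_of_nonneg_left h3 (by positivity)
      _ = 2 * ((A : ℝ) + 4) * D * (κ * x * L ^ (A + 3)) := by ring
  have hT2 : (x : ℝ) * D / X * (2 * Real.sqrt (X + κ * X)) ≤ 2 * Real.sqrt 2 * D * K₁ * (x / L ^ A) := by
    have h1 : (x : ℝ) * D / X * (2 * Real.sqrt (X + κ * X)) ≤ (x : ℝ) * D / X * (2 * (Real.sqrt 2 * Real.sqrt X)) :=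
      mul_le_mul_of_nonneg_left (by linarith) (by positivity)
    have h2 : (x : ℝ) * D / X * (2 * (Real.sqrt 2 * Real.sqrt X)) = 2 * Real.sqrt 2 * D * (x / Real.sqrt X) := by
      have key : (x : ℝ) / Real.sqrt X = (x : ℝ) * Real.sqrt X / X := by
        rw [div_eq_div_iff hsX.ne' hX0.ne', mul_assoc, Real.mul_self_sqrt hX0.le]
      rw [key]
      ring
    have h3 : (x : ℝ) / Real.sqrt X ≤ (x : ℝ) / (x : ℝ) ^ (1 / 4 : ℝ) :=
      div_le_div_of_nonneg_left hx0.le (by positivity) hsqrtX_lo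
    calc (x : ℝ) * D / X * (2 * Real.sqrt (X + κ * X)) ≤ 2 * Real.sqrt 2 * D * (x / Real.sqrt X) := h1.trans_eq h2
      _ ≤ 2 * Real.sqrt 2 * D * (K₁ * x / L ^ A) :=
          mul_le_mul_of_nonneg_left (h3.trans h34) (by positivity)
      _ = 2 * Real.sqrt 2 * D * K₁ * (x / L ^ A) := by ring
  have hT3 : 1 * (2 * (κ * X) * (1 + Real.log (X + κ * X))) ≤ 2 * ((A : ℝ) + 4) * (κ * x * L ^ (A + 3)) := by
    rw [one_mul]
    have h1 : κ * X ≤ κ * (x * L ^ (A + 1)) := mul_le_mul_of_nonneg_left hXhi hκ0.le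
    calc 2 * (κ * X) * (1 + Real.log (X + κ * X)) ≤ 2 * (κ * (x * L ^ (A + 1))) * (((A : ℝ) + 4) * L) :=
          mul_le_mul (by linarith) hM hM0 (by positivity)
      _ = 2 * ((A : ℝ) + 4) * (κ * x * L ^ (A + 2)) := by ring
      _ ≤ 2 * ((A : ℝ) + 4) * (κ * x * L ^ (A + 3)) := by
          refine mul_le_mul_of_nonneg_left (mul_le_mul_of_nonneg_left ?_ (by positivity)) (by positivity)
          exact pow_le_pow_right₀ hL1 (by omega)
  have hT4 : 1 * (2 * Real.sqrt (X + κ * X)) ≤ 2 * Real.sqrt 2 * K₂ * (x / L ^ A) := by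
    rw [one_mul]
    calc 2 * Real.sqrt (X + κ * X) ≤ 2 * (Real.sqrt 2 * Real.sqrt X) := by linarith
      _ ≤ 2 * (Real.sqrt 2 * (Real.sqrt x * L ^ (A + 1))) := by gcongr
      _ ≤ 2 * (Real.sqrt 2 * (K₂ * x / L ^ A)) := by gcongr
      _ = 2 * Real.sqrt 2 * K₂ * (x / L ^ A) := by ring
  -- assemble
  have hκxL : 0 ≤ κ * x * L ^ (A + 3) := by positivity
  have hxL : 0 ≤ (x : ℝ) / L ^ A := by positivity
  calc ((x : ℝ) * D / X + 1) * (2 * (κ * X) * (1 + Real.log (X + κ * X)) + 2 * Real.sqrt (X + κ * X))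
      = (x : ℝ) * D / X * (2 * (κ * X) * (1 + Real.log (X + κ * X))) +
          (x : ℝ) * D / X * (2 * Real.sqrt (X + κ * X)) +
          1 * (2 * (κ * X) * (1 + Real.log (X + κ * X))) + 1 * (2 * Real.sqrt (X + κ * X)) := by ring
    _ ≤ 2 * ((A : ℝ) + 4) * D * (κ * x * L ^ (A + 3)) + 2 * Real.sqrt 2 * D * K₁ * (x / L ^ A) +
          2 * ((A : ℝ) + 4) * (κ * x * L ^ (A + 3)) + 2 * Real.sqrt 2 * K₂ * (x / L ^ A) :=
        add_le_add (add_le_add (add_le_add hT1 hT2) hT3) hT4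
    _ = (2 * ((A : ℝ) + 4) * (D + 1)) * (κ * x * L ^ (A + 3)) +
          (2 * Real.sqrt 2 * (D * K₁ + K₂)) * (x / L ^ A) := by ring
    _ ≤ (2 * ((A : ℝ) + 4) * (D + 1) + 2 * Real.sqrt 2 * (D * K₁ + K₂)) *
          (κ * x * L ^ (A + 3) + x / L ^ A) := by
        have h1 : 0 ≤ 2 * ((A : ℝ) + 4) * (D + 1) := by positivity
        have h2 : 0 ≤ 2 * Real.sqrt 2 * (D * K₁ + K₂) := by positivity
        nlinarith [mul_nonneg h1 hxL, mul_nonneg h2 hκxL]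

/-- **Regime `x (log x)^{A+1} ≤ X ≤ x^{3/2}`** of the shell bound (switched count): for `x ≥ 3`,
`q₀, q₁ ≥ 1`, `x (log x)^{A+1} ≤ X ≤ x^{3/2}`, `0 < κ ≤ 1` the shell count with `Y = κX` is at most
`C (κ x (log x)^{A+3} + x/(log x)^A)` (here the complementary divisors have product at most
`W = c x²/X ≤ c x/(log x)^{A+1}`, `c = (q₀ + |a₀|)(q₁ + |a₁|)`). [folklore] -/
theorem card_shell_le_of_ge {q₀ a₀ q₁ a₁ : ℤ} (hq₀ : IsCoprime q₀ a₀) (hq₁ : IsCoprime q₁ a₁)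
    (hq₀p : 0 < q₀) (hq₁p : 0 < q₁) (hΔ : q₁ * a₀ - q₀ * a₁ ≠ 0) (A : ℕ) :
    ∃ C : ℝ, 0 < C ∧ ∀ (x B : ℕ) (X κ : ℝ), 3 ≤ x → (x : ℝ) * Real.log x ^ (A + 1) ≤ X →
      X ≤ (x : ℝ) ^ (3 / 2 : ℝ) → 0 < κ → κ ≤ 1 →
      ((((Icc 1 x) ×ˢ ((Icc 1 B) ×ˢ (Icc 1 B))).filter fun c : ℕ × ℕ × ℕ =>
        ((1 ≤ q₀ * c.1 + a₀ ∧ (c.2.1 : ℤ) ∣ q₀ * c.1 + a₀) ∧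
          (1 ≤ q₁ * c.1 + a₁ ∧ (c.2.2 : ℤ) ∣ q₁ * c.1 + a₁)) ∧
        (X < (c.2.1 : ℝ) * c.2.2 ∧ (c.2.1 : ℝ) * c.2.2 ≤ X + κ * X)).card : ℝ) ≤
      C * (κ * x * Real.log x ^ (A + 3) + x / Real.log x ^ A) := by
  obtain ⟨D, hD⟩ : ∃ D : ℝ, D = |((q₁ * a₀ - q₀ * a₁ : ℤ) : ℝ)| := ⟨_, rfl⟩
  have hD0 : 0 ≤ D := by rw [hD]; exact abs_nonneg _
  have hq₀R : (1 : ℝ) ≤ q₀ := by exact_mod_cast hq₀p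
  have hq₁R : (1 : ℝ) ≤ q₁ := by exact_mod_cast hq₁p
  have ha₀ : 0 ≤ |(a₀ : ℝ)| := abs_nonneg _
  have ha₁ : 0 ≤ |(a₁ : ℝ)| := abs_nonneg _
  -- the constant `c = (q₀ + |a₀|)(q₁ + |a₁|) ≥ 1`
  obtain ⟨c, hc⟩ : ∃ c : ℝ, c = ((q₀ : ℝ) + |(a₀ : ℝ)|) * ((q₁ : ℝ) + |(a₁ : ℝ)|) := ⟨_, rfl⟩
  have hc1 : 1 ≤ c := by
    have h0 : (1 : ℝ) ≤ (q₀ : ℝ) + |(a₀ : ℝ)| := by linarith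
    have h1 : (1 : ℝ) ≤ (q₁ : ℝ) + |(a₁ : ℝ)| := by linarith
    rw [hc]; exact one_le_mul_of_one_le_of_one_le h0 h1
  have hc0 : 0 < c := by linarith
  have hlogc : 0 ≤ Real.log c := Real.log_nonneg hc1
  obtain ⟨c', hc'⟩ : ∃ c' : ℝ, c' = Real.log c + 2 := ⟨_, rfl⟩
  have hc'0 : 0 < c' := by rw [hc']; linarith
  have hC₁ : 0 ≤ (1 + |(a₀ : ℝ)|) * D * c' ^ 2 :=
    mul_nonneg (mul_nonneg (by linarith) hD0) (sq_nonneg _)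
  have hC₂ : 0 ≤ c * c' := mul_nonneg hc0.le hc'0.le
  refine ⟨(1 + |(a₀ : ℝ)|) * D * c' ^ 2 + c * c', by linarith [mul_pos hc0 hc'0], ?_⟩
  intro x B X κ hx3 hXlo hXhi hκ0 hκ1
  have hx3R : (3 : ℝ) ≤ x := by exact_mod_cast hx3
  have hx0 : (0 : ℝ) < x := by linarith
  have hx1 : (1 : ℝ) ≤ x := by linarith
  obtain ⟨hL1, hLx⟩ := one_le_log_of_three_le hx3R
  obtain ⟨L, hL⟩ : ∃ L : ℝ, L = Real.log x := ⟨_, rfl⟩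
  rw [← hL] at hL1 hLx hXlo ⊢
  have hL0 : 0 < L := by linarith
  have hLA1 : 1 ≤ L ^ (A + 1) := one_le_pow₀ hL1
  have hLA0 : 0 < L ^ A := pow_pos hL0 A
  have hLA10 : 0 < L ^ (A + 1) := pow_pos hL0 (A + 1)
  have hLA30 : 0 < L ^ (A + 3) := pow_pos hL0 (A + 3)
  -- `x ≤ x L^{A+1} ≤ X ≤ x^{3/2} ≤ x²`
  have hxX : (x : ℝ) ≤ X := by
    calc (x : ℝ) = x * 1 := (mul_one _).symm
      _ ≤ x * L ^ (A + 1) := mul_le_mul_of_nonneg_left hLA1 hx0.le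
      _ ≤ X := hXlo
  have hX0 : 0 < X := by linarith
  have hXx2 : X ≤ (x : ℝ) ^ 2 := by
    calc X ≤ (x : ℝ) ^ (3 / 2 : ℝ) := hXhi
      _ ≤ (x : ℝ) ^ (2 : ℝ) := Real.rpow_le_rpow_of_exponent_le hx1 (by norm_num)
      _ = (x : ℝ) ^ 2 := by rw [Real.rpow_two]
  clear hXhi
  have hx20 : 0 < (x : ℝ) ^ 2 := pow_pos hx0 2
  -- the parameter `W`
  obtain ⟨W, hW⟩ : ∃ W : ℝ, W = c * (x : ℝ) ^ 2 / X := ⟨_, rfl⟩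
  have hWX : W * X = c * (x : ℝ) ^ 2 := by rw [hW, div_mul_cancel₀ _ hX0.ne']
  have hW1 : 1 ≤ W := by
    rw [hW, le_div_iff₀ hX0, one_mul]
    calc X ≤ (x : ℝ) ^ 2 := hXx2
      _ = 1 * (x : ℝ) ^ 2 := (one_mul _).symm
      _ ≤ c * (x : ℝ) ^ 2 := mul_le_mul_of_nonneg_right hc1 hx20.le
  have hW0 : 0 < W := by linarith
  have hcx0 : 0 ≤ c * x := mul_nonneg hc0.le hx0.le
  have hWle : W ≤ c * x / L ^ (A + 1) := by
    rw [hW, div_le_div_iff₀ hX0 hLA10]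
    calc c * (x : ℝ) ^ 2 * L ^ (A + 1) = c * x * (x * L ^ (A + 1)) := by ring
      _ ≤ c * x * X := mul_le_mul_of_nonneg_left hXlo hcx0
  have hWle' : W ≤ c * x := by
    refine hWle.trans ?_
    rw [div_le_iff₀ hLA10]
    calc c * (x : ℝ) = c * x * 1 := (mul_one _).symm
      _ ≤ c * x * L ^ (A + 1) := mul_le_mul_of_nonneg_left hLA1 hcx0
  have hFW : ((q₀ : ℝ) * x + |(a₀ : ℝ)|) * ((q₁ : ℝ) * x + |(a₁ : ℝ)|) ≤ W * X := by
    rw [hWX, hc]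
    have h0 : (q₀ : ℝ) * x + |(a₀ : ℝ)| ≤ ((q₀ : ℝ) + |(a₀ : ℝ)|) * x := by
      rw [add_mul]; linarith [mul_le_mul_of_nonneg_left hx1 ha₀]
    have h1 : (q₁ : ℝ) * x + |(a₁ : ℝ)| ≤ ((q₁ : ℝ) + |(a₁ : ℝ)|) * x := by
      rw [add_mul]; linarith [mul_le_mul_of_nonneg_left hx1 ha₁]
    have h0' : 0 ≤ (q₀ : ℝ) * x + |(a₀ : ℝ)| :=
      add_nonneg (mul_nonneg (by linarith) hx0.le) ha₀
    have h1' : 0 ≤ (q₁ : ℝ) * x + |(a₁ : ℝ)| :=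
      add_nonneg (mul_nonneg (by linarith) hx0.le) ha₁
    calc ((q₀ : ℝ) * x + |(a₀ : ℝ)|) * ((q₁ : ℝ) * x + |(a₁ : ℝ)|)
        ≤ (((q₀ : ℝ) + |(a₀ : ℝ)|) * x) * (((q₁ : ℝ) + |(a₁ : ℝ)|) * x) :=
          mul_le_mul h0 h1 h1' (h0'.trans h0)
      _ = ((q₀ : ℝ) + |(a₀ : ℝ)|) * ((q₁ : ℝ) + |(a₁ : ℝ)|) * (x : ℝ) ^ 2 := by ring
  have hκX : 0 ≤ κ * X := (mul_pos hκ0 hX0).le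
  refine (card_shell_le_switched hq₀p hq₁p hq₀ hq₁ hΔ x B hX0 hκX hW1 hFW).trans ?_
  rw [← hD]
  -- `1 + log W ≤ c' L`
  have hlogW : 1 + Real.log W ≤ c' * L := by
    have h1 : Real.log W ≤ Real.log c + L := by
      calc Real.log W ≤ Real.log (c * x) := Real.log_le_log hW0 hWle'
        _ = Real.log c + L := by rw [Real.log_mul hc0.ne' hx0.ne', hL]
    have h2 : Real.log c ≤ Real.log c * L := le_mul_of_one_le_right hlogc hL1
    rw [hc', add_mul]
    linarith
  have hlogW0 : 0 ≤ 1 + Real.log W := by have := Real.log_nonneg hW1; linarith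
  -- the two terms
  have hT1 : ((x : ℝ) + |(a₀ : ℝ)|) * (κ * X) / X * D * (1 + Real.log W) ^ 2 ≤
      (1 + |(a₀ : ℝ)|) * D * c' ^ 2 * (κ * x * L ^ (A + 3)) := by
    have h1 : ((x : ℝ) + |(a₀ : ℝ)|) * (κ * X) / X = ((x : ℝ) + |(a₀ : ℝ)|) * κ := by
      rw [mul_div_assoc, mul_div_cancel_right₀ κ hX0.ne']
    rw [h1]
    have h2 : (x : ℝ) + |(a₀ : ℝ)| ≤ (1 + |(a₀ : ℝ)|) * x := by
      rw [add_mul, one_mul]; linarith [mul_le_mul_of_nonneg_left hx1 ha₀]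
    have h3 : (1 + Real.log W) ^ 2 ≤ (c' * L) ^ 2 := pow_le_pow_left₀ hlogW0 hlogW 2
    have h4 : L ^ 2 ≤ L ^ (A + 3) := pow_le_pow_right₀ hL1 (by omega)
    have hκx : 0 ≤ κ * (x : ℝ) := (mul_pos hκ0 hx0).le
    have h5 : κ * (x : ℝ) * L ^ 2 ≤ κ * (x : ℝ) * L ^ (A + 3) :=
      mul_le_mul_of_nonneg_left h4 hκx
    have h6 : 0 ≤ (1 + |(a₀ : ℝ)|) * (x : ℝ) * κ * D :=
      mul_nonneg (mul_nonneg (mul_nonneg (by linarith) hx0.le) hκ0.le) hD0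
    calc ((x : ℝ) + |(a₀ : ℝ)|) * κ * D * (1 + Real.log W) ^ 2
        ≤ ((1 + |(a₀ : ℝ)|) * x) * κ * D * (c' * L) ^ 2 := by
          refine mul_le_mul ?_ h3 (sq_nonneg _) h6
          exact mul_le_mul_of_nonneg_right (mul_le_mul_of_nonneg_right h2 hκ0.le) hD0
      _ = (1 + |(a₀ : ℝ)|) * D * c' ^ 2 * (κ * x * L ^ 2) := by ring
      _ ≤ (1 + |(a₀ : ℝ)|) * D * c' ^ 2 * (κ * x * L ^ (A + 3)) :=
          mul_le_mul_of_nonneg_left h5 hC₁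
  have hT2 : W * (1 + Real.log W) ≤ c * c' * (x / L ^ A) := by
    have h1 : W * (1 + Real.log W) ≤ (c * x / L ^ (A + 1)) * (c' * L) :=
      mul_le_mul hWle hlogW hlogW0 (div_nonneg hcx0 hLA10.le)
    have h2 : c * x / L ^ (A + 1) * (c' * L) = c * c' * (x / L ^ A) := by
      rw [div_mul_eq_mul_div, mul_div_assoc', div_eq_div_iff hLA10.ne' hLA0.ne']
      ring
    rw [← h2]; exact h1
  have hκxL : 0 ≤ κ * x * L ^ (A + 3) := (mul_pos (mul_pos hκ0 hx0) hLA30).le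
  have hxL : 0 ≤ (x : ℝ) / L ^ A := div_nonneg hx0.le hLA0.le
  calc ((x : ℝ) + |(a₀ : ℝ)|) * (κ * X) / X * D * (1 + Real.log W) ^ 2 + W * (1 + Real.log W)
      ≤ (1 + |(a₀ : ℝ)|) * D * c' ^ 2 * (κ * x * L ^ (A + 3)) + c * c' * (x / L ^ A) :=
        add_le_add hT1 hT2
    _ ≤ ((1 + |(a₀ : ℝ)|) * D * c' ^ 2 + c * c') * (κ * x * L ^ (A + 3) + x / L ^ A) := by
        have h1 := mul_nonneg hC₁ hxL
        have h2 := mul_nonneg hC₂ hκxL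
        nlinarith only [h1, h2]

/-- **Divisor pairs of two linear forms in a thin hyperbolic shell.**  Let `q₀, q₁ ≥ 1`,
`gcd(q₀,a₀) = gcd(q₁,a₁) = 1`, `Δ = q₁a₀ − q₀a₁ ≠ 0` and `A ∈ ℕ`.  There is `C > 0` such that for
all naturals `x ≥ 3`, `B`, all `x^{1/2} ≤ X ≤ x^{3/2}` and `0 < κ ≤ 1`, the number of
`(n, d₀, d₁) ∈ [1,x] × [1,B]²` with `d₀ ∣ q₀n + a₀ ≥ 1`, `d₁ ∣ q₁n + a₁ ≥ 1` and
`X < d₀d₁ ≤ (1 + κ)X` is at most `C (κ x (log x)^{A+3} + x (log x)^{−A})` (uniformly in `B`).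
For `X ≤ x (log x)^{A+1}` this is the direct count over the pairs `(d₀,d₁)` of the shell
(`card_shell_le_of_le`), for larger `X` the count through the complementary divisors
(`card_shell_le_of_ge`). [folklore] -/
theorem card_shell_le {q₀ a₀ q₁ a₁ : ℤ} (hq₀ : IsCoprime q₀ a₀) (hq₁ : IsCoprime q₁ a₁)
    (hq₀p : 0 < q₀) (hq₁p : 0 < q₁) (hΔ : q₁ * a₀ - q₀ * a₁ ≠ 0) (A : ℕ) :
    ∃ C : ℝ, 0 < C ∧ ∀ (x B : ℕ) (X κ : ℝ), 3 ≤ x → (x : ℝ) ^ (1 / 2 : ℝ) ≤ X →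
      X ≤ (x : ℝ) ^ (3 / 2 : ℝ) → 0 < κ → κ ≤ 1 →
      ((((Icc 1 x) ×ˢ ((Icc 1 B) ×ˢ (Icc 1 B))).filter fun c : ℕ × ℕ × ℕ =>
        ((1 ≤ q₀ * c.1 + a₀ ∧ (c.2.1 : ℤ) ∣ q₀ * c.1 + a₀) ∧
          (1 ≤ q₁ * c.1 + a₁ ∧ (c.2.2 : ℤ) ∣ q₁ * c.1 + a₁)) ∧
        (X < (c.2.1 : ℝ) * c.2.2 ∧ (c.2.1 : ℝ) * c.2.2 ≤ X + κ * X)).card : ℝ) ≤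
      C * (κ * x * Real.log x ^ (A + 3) + x / Real.log x ^ A) := by
  obtain ⟨C₁, hC₁, h₁⟩ := card_shell_le_of_le hq₀ hq₁ hΔ A
  obtain ⟨C₂, hC₂, h₂⟩ := card_shell_le_of_ge hq₀ hq₁ hq₀p hq₁p hΔ A
  refine ⟨C₁ + C₂, by positivity, ?_⟩
  intro x B X κ hx3 hXlo hXhi hκ0 hκ1
  have hx3R : (3 : ℝ) ≤ x := by exact_mod_cast hx3
  have hL0 : 0 < Real.log x := Real.log_pos (by linarith)
  have hR : 0 ≤ κ * x * Real.log x ^ (A + 3) + x / Real.log x ^ A := by positivity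
  rcases le_or_gt X ((x : ℝ) * Real.log x ^ (A + 1)) with hle | hgt
  · refine (h₁ x B X κ hx3 hXlo hle hκ0 hκ1).trans ?_
    nlinarith
  · refine (h₂ x B X κ hx3 hgt.le hXhi hκ0 hκ1).trans ?_
    nlinarith

end LinearPairShells

end Literature.NumberTheory.Sieve
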